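/-
Copyright: the b2b-balaban T⁴-continuum CRUX team, row NE7b owner lineage `t4-ne7b-p1` (gen 115). Project licence.
-/
import Summits.QuantumFields.BalabanUV.T4Continuum.Spine.NE7b.OneShotChartWeightedRows

/-!
# A POSITIVE RATE FOR THE WHOLE SUP ROAD: if the two smallness conditions of (63) ∕ (66) hold at rate `0` —
# `2λ·C_Γ(0) < 1` and `λ·K₁(0)·(C_Q(0) + 2C_G(0)) < 1`, explicit `O(λ)` conditions on the perturbation letter — then SOME `μ > 0`
# below `δ_H` and `δ_u∕4` satisfies BOTH at rate `μ`, because every constant of the road is a continuous function of the rate through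
# `K_d(b) = (2(1 − e^{−b∕d})⁻¹)^d`: the localisation letters (63) ∕ (64) ∕ (65) AND the next-scale propagator letter (66) hold
# SIMULTANEOUSLY at one positive decay rate (existential) (row NE7b, node U5c; real analysis only; [folklore])

Cell `pub-balaban`, sub-cell `t4`, spine estimate NE7b (`T4WeightBudget.RelWeightBound`; the cell's OWN estimate — NOT PRINTED in
[Bałaban 1983–89], NOT PROVED).  Crux-route work under `Spine/NE7b/` by the row OWNER (`t4-ne7b-p1` gen 115) under FREEZE (0)'s
crux-prover clause (FILING-CLAIM C-ne7bp1-g115-8); NOTHING of Bałaban's is named, valued or asserted; no `def`, no notation; zero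
`sorry`.  Imports (BY NAME): (62) `…OneShotChartWeightedRows` for the constants' vocabulary only (`cHs`, `cU`, `cG0`, `cKL`, `cSplit`,
`cFar`, `deltaH`, `deltaU`, `latticeConst`); Mathlib `ContinuousAt.inv₀`, `Filter.Tendsto.eventually_lt`, `Metric.eventually_nhds_iff`.

WHY (located).  (64) §5 `exists_admissible_rate` gave a positive rate for (63)'s condition alone; (66) §3 adds
`θ(μ) = λ·K₁(μ)·(C_Q(μ) + 2C_G(μ)) < 1` with `K₁(μ) = (1 − 2λC_Γ(μ))⁻¹C_H(μ)`.  A consumer who wants every letter at ONE rate needs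
both eventually-true statements intersected near `0` — this file, so that «at some positive rate» is one hypothesis-free sentence
given the two rate-`0` conditions.

WHAT IS PROVED ([folklore]): `tendsto_latticeConst_sub` (`μ ↦ K_d(b − μ)` is continuous at `0` for `b > 0`, `d ≥ 1`);
**`exists_joint_rate`** (`d ≥ 3`): the statement of the title, with all constants written out.

HONEST (what this is NOT).  Existential rate, no value; nothing about the size of the window; constants useless by value; nothing of
Bałaban's.  BY-NAME EFFECT ON THE WALL: NONE.  NE7b NOT PRINTED ∕ NOT PROVED; spine PROVED 0∕9; rung (B)+1 on a FINITE torus — NOT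
infinite volume, NOT the mass gap, NOT Clay.  HONEST DEPENDENCY: continuum YM on T⁴ ⇐ BetaPertH ∧ nine spine estimates (0∕9
proved); BetaPertH ⇐ (D1) ∧ (D4) ∧ CAP+tail; G-an2-4 gates asym, D1 and NE2∕3∕4.
-/

set_option autoImplicit false

namespace Summit.QuantumFields.BalabanUV.T4Continuum.NE7b.SupNextScaleRate

open Filter
open scoped Topology
open Literature.MathematicalPhysics.QuantumFieldTheory.Balaban1983to89
open B4Sect5Proof (latticeConst latticeConst_nonneg)
open B6QGQDecay237 (deltaU deltaU_pos cU)
open B5Hk103ScalarZd (deltaH deltaH_pos)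
open Summit.QuantumFields.BalabanUV.Beta.D1BFx.BlockColumnSupNorm (cHs)
open Summit.QuantumFields.BalabanUV.Beta.D1BFx.PointColumnSplit (cKL cG0 cSplit)
open Summit.QuantumFields.BalabanUV.Beta.D1BFx.PointColumnDecay (cFar)

variable {d : ℕ}

/-- **`K_d` is continuous at positive rates**: `μ ↦ K_d(b − μ)` tends to `K_d(b)` as `μ → 0` (`b > 0`, `d ≥ 1`). [folklore] -/
theorem tendsto_latticeConst_sub (hd : 1 ≤ d) {b : ℝ} (hb : 0 < b) :
    Tendsto (fun μ : ℝ => latticeConst d (b - μ)) (𝓝 0) (𝓝 (latticeConst d b)) := by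
  have hd0 : (0 : ℝ) < d := by exact_mod_cast (show 0 < d by omega)
  have hne : (fun μ : ℝ => 1 - Real.exp (-((b - μ) / (d : ℝ)))) 0 ≠ 0 := by
    have h1 : Real.exp (-((b - 0) / (d : ℝ))) < 1 := by
      rw [← Real.exp_zero]
      exact Real.exp_lt_exp.2 (by rw [sub_zero]; exact neg_neg_of_pos (div_pos hb hd0))
    show 1 - Real.exp (-((b - 0) / (d : ℝ))) ≠ 0
    linarith
  have hc : ContinuousAt (fun μ : ℝ => ((2 : ℝ) * (1 - Real.exp (-((b - μ) / (d : ℝ))))⁻¹) ^ d) 0 :=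
    (continuousAt_const.mul
      (ContinuousAt.inv₀ (f := fun μ : ℝ => 1 - Real.exp (-((b - μ) / (d : ℝ)))) (by fun_prop) hne)).pow d
  simpa only [latticeConst, sub_zero] using hc.tendsto

/-- **ONE POSITIVE RATE FOR BOTH SMALLNESS CONDITIONS** (`d ≥ 3`): if `2λC_Γ(0) < 1` and `λ·((1 − 2λC_Γ(0))⁻¹C_H(0))·(C_Q(0) + 2C_G(0)) < 1`
then some `μ > 0` with `μ < δ_H`, `μ < δ_u∕4` has `2λC_Γ(μ) < 1` and `λ·((1 − 2λC_Γ(μ))⁻¹C_H(μ))·(C_Q(μ) + 2C_G(μ)) < 1`, where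
`C_H(μ) = cHs K_d(δ_H − μ)`, `C_G(μ) = A_G K_d(δ_u∕4 − μ)`, `C_Γ(μ) = C_G(μ)(1 + C_H(μ))`, `C_Q(μ) = cU K_d(δ_u − μ)`. [folklore] -/
theorem exists_joint_rate (hd : 3 ≤ d) {a : ℝ} (ha : 0 < a) {lam : ℝ}
    (h1 : 2 * lam * (((cG0 d * cKL d (d - 2) + cSplit d a) * Real.exp (2 * deltaU d a)
        + cFar d a * Real.exp (4 * deltaU d a) / deltaU d a ^ 2) * latticeConst d (deltaU d a / 4)
          * (1 + cHs d a * latticeConst d (deltaH d a))) < 1)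
    (h2 : lam * ((1 - 2 * lam * (((cG0 d * cKL d (d - 2) + cSplit d a) * Real.exp (2 * deltaU d a)
        + cFar d a * Real.exp (4 * deltaU d a) / deltaU d a ^ 2) * latticeConst d (deltaU d a / 4)
          * (1 + cHs d a * latticeConst d (deltaH d a))))⁻¹ * (cHs d a * latticeConst d (deltaH d a)))
        * (cU d a * latticeConst d (deltaU d a)
          + 2 * (((cG0 d * cKL d (d - 2) + cSplit d a) * Real.exp (2 * deltaU d a)
            + cFar d a * Real.exp (4 * deltaU d a) / deltaU d a ^ 2) * latticeConst d (deltaU d a / 4))) < 1) :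
    ∃ μ : ℝ, 0 < μ ∧ μ < deltaH d a ∧ μ < deltaU d a / 4 ∧
      2 * lam * (((cG0 d * cKL d (d - 2) + cSplit d a) * Real.exp (2 * deltaU d a)
        + cFar d a * Real.exp (4 * deltaU d a) / deltaU d a ^ 2) * latticeConst d (deltaU d a / 4 - μ)
          * (1 + cHs d a * latticeConst d (deltaH d a - μ))) < 1 ∧
      lam * ((1 - 2 * lam * (((cG0 d * cKL d (d - 2) + cSplit d a) * Real.exp (2 * deltaU d a)
        + cFar d a * Real.exp (4 * deltaU d a) / deltaU d a ^ 2) * latticeConst d (deltaU d a / 4 - μ)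
          * (1 + cHs d a * latticeConst d (deltaH d a - μ))))⁻¹ * (cHs d a * latticeConst d (deltaH d a - μ)))
        * (cU d a * latticeConst d (deltaU d a - μ)
          + 2 * (((cG0 d * cKL d (d - 2) + cSplit d a) * Real.exp (2 * deltaU d a)
            + cFar d a * Real.exp (4 * deltaU d a) / deltaU d a ^ 2) * latticeConst d (deltaU d a / 4 - μ))) < 1 := by
  have hd1 : 1 ≤ d := by omega
  have hδH := deltaH_pos d ha
  have hδU := deltaU_pos d ha
  have hδU4 : 0 < deltaU d a / 4 := by positivity
  -- the three rate-dependent `K_d`'s tend to their values at `0`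
  have tH := tendsto_latticeConst_sub hd1 hδH
  have tG := tendsto_latticeConst_sub hd1 hδU4
  have tQ := tendsto_latticeConst_sub hd1 hδU
  -- the first condition's left side
  have tΓ := (((tG.const_mul ((cG0 d * cKL d (d - 2) + cSplit d a) * Real.exp (2 * deltaU d a)
      + cFar d a * Real.exp (4 * deltaU d a) / deltaU d a ^ 2)).mul ((tH.const_mul (cHs d a)).const_add 1)).const_mul (2 * lam))
  have hev1 := tΓ.eventually_lt tendsto_const_nhds h1
  -- the second condition's left side: the inverse is continuous since `1 − 2λC_Γ(0) ≠ 0`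
  have hne : (1 : ℝ) - 2 * lam * (((cG0 d * cKL d (d - 2) + cSplit d a) * Real.exp (2 * deltaU d a)
      + cFar d a * Real.exp (4 * deltaU d a) / deltaU d a ^ 2) * latticeConst d (deltaU d a / 4)
        * (1 + cHs d a * latticeConst d (deltaH d a))) ≠ 0 := (sub_pos.2 h1).ne'
  have tK := (((tΓ.const_sub 1).inv₀ hne).mul (tH.const_mul (cHs d a))).const_mul lam
  have tS := (tQ.const_mul (cU d a)).add ((tG.const_mul ((cG0 d * cKL d (d - 2) + cSplit d a) * Real.exp (2 * deltaU d a)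
      + cFar d a * Real.exp (4 * deltaU d a) / deltaU d a ^ 2)).const_mul 2)
  have hev2 := (tK.mul tS).eventually_lt tendsto_const_nhds h2
  obtain ⟨ε, hε, hεp⟩ := Metric.eventually_nhds_iff.1 (hev1.and hev2)
  refine ⟨min (ε / 2) (min (deltaH d a / 2) (deltaU d a / 8)), by positivity, ?_, ?_, ?_⟩
  · exact (min_le_right _ _).trans_lt ((min_le_left _ _).trans_lt (by linarith))
  · exact (min_le_right _ _).trans_lt ((min_le_right _ _).trans_lt (by linarith))
  · have hμε : dist (min (ε / 2) (min (deltaH d a / 2) (deltaU d a / 8))) 0 < ε := by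
      rw [Real.dist_eq, sub_zero, abs_of_pos (by positivity)]
      exact (min_le_left _ _).trans_lt (by linarith)
    exact hεp hμε

end Summit.QuantumFields.BalabanUV.T4Continuum.NE7b.SupNextScaleRate
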